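import Summits.BirchSwinnertonDyer.BirchSwinnertonDyer.Theorems.SignedLowerHalvesSprungLowerDivisibilityAtThreeSlopeSeparationSegment
import Summits.BirchSwinnertonDyer.BirchSwinnertonDyer.Theorems.SignedLowerHalvesSprungLowerDivisibilityAtThreeSlopeSeparationResidual
import HarnessLib

/-!
# Crux `SprungLowerDivisibilityAtThree` (item stmt-BirchSwinnertonDyer-19875), line `chromatic-common-zeros`:
# second-order (residual) separation for ANY leading valuation under the STRICT chord condition —
# `‖F_0‖ = ‖G_0‖ = c`, `λ(F) = λ(G)`, intermediate coefficients strictly above the chord,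
# `‖F_0·G_λ − G_0·F_λ‖ = c` ⟹ no common zero, no common height-one prime (pure `p`-adic algebra, any `p`)

Cell `bsd-ssimc` (host) / lead `cruxlead-stmt-BirchSwinnertonDyer-19875`; width seat `-w3` (gen 3);
`--supports` 19875 `--as helper`; THEOREMS ONLY (no definition, no named fact, nothing about any curve
asserted); closes no item; BSD / K1 / leaf X8 are NOT proved by anything here.

Joins `…SlopeSeparationSegment.lean` (p625449: under the chord condition every zero of `G` has
`|z|^{λ(G)} = ‖G_0‖`) and `…SlopeSeparationResidual.lean` (p626393: the residual test at leading valuation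
`1`). At leading valuation `v(G_0) ≥ 2` (x8 R5 table: the `suspect` cells with equal Newton polygons, e.g.
slopes `1,1 ∣ 1,1` or `2,2 ∣ 2,2`) the residual test still applies provided the intermediate coefficients lie
STRICTLY above the chord (`‖G_k‖^λ < ‖G_0‖^{λ−k}`, `0 < k < λ`): then on the circle of zeros `G` is again its
leading binomial `G_0 + G_λ z^λ` up to terms of absolute value `< ‖G_0‖`, and the certificate
`‖F_0·G_λ − G_0·F_λ‖ = ‖F_0‖` (`= ‖G_0‖`) forbids a common zero.

## What is proved (`G(z) = ∑ ι(G_k) z^k`, `|z| < 1` in `ℂ_p`; `c = ‖G_0‖`, `λ = λ(G)`, `μ(G) = 0`)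

* §1 `norm_leading_binomial_lt_of_hasSum_zero_of_strictChord` — strict chord, `G(z) = 0` ⟹
  `‖ι(G_0) + ι(G_λ) z^λ‖ < c`.
* §2 `not_common_zero_of_residual_of_strictChord`, `not_mem_and_mem_of_residual_of_strictChord` — two such
  `F, G` with `‖F_0‖ = ‖G_0‖`, `λ(F) = λ(G)` and `‖F_0·G_λ − G_0·F_λ‖ = ‖F_0‖`: no common zero, no common
  height-one prime; `not_mem_and_mem_of_X_mul_of_residual_of_strictChord` (off `(T)`).

References (ATTRIBUTION): [Koblitz1984] Ch. IV §3–§4; [Washington1997] §7.1–7.2, Thm. 7.3, §13.2;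
[Lang1990] Ch. 5 §2. Tree: `…SlopeSeparation{,Segment,Residual}.lean`.
-/

set_option autoImplicit false
-- justification: the mandated namespace `Summit.BirchSwinnertonDyer.BirchSwinnertonDyer.Theorems`
-- (single-conjunct summit, Sub = Summit) repeats a segment by design (D-0017).
set_option linter.dupNamespace false

noncomputable section

open scoped Classical

open Polynomial Literature.NumberTheory.EllipticCurves
  Summit.BirchSwinnertonDyer.Rank1Residual.X1.MuLambda
  Summit.BirchSwinnertonDyer.Rank1Residual.Iwasawa

namespace Summit.BirchSwinnertonDyer.BirchSwinnertonDyer.Theorems.ChromaticSlopeSeparation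

variable {p : ℕ} [hp : Fact p.Prime]

/-! ## §1. The leading binomial at a zero, strict chord condition -/

section Leading

/-- **The leading binomial at a zero (strict chord).** For `G ∈ Λ ∖ {0}` with `μ(G) = 0`, `G_0 ≠ 0` and the
STRICT chord condition `‖G_k‖^λ < ‖G_0‖^{λ−k}` (`0 < k < λ = λ(G)`), at a zero `z` of `G` in the open disc
(where `|z|^λ = ‖G_0‖`): `‖ι(G_0) + ι(G_λ) z^λ‖ < ‖G_0‖` — the other terms are `< ‖G_0‖` uniformly
(`(‖G_k‖|z|^k)^λ = ‖G_k‖^λ ‖G_0‖^k < ‖G_0‖^λ` for `0 < k < λ`; `|z|^k ≤ |z|^λ·|z| = ‖G_0‖·|z|` for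
`k > λ`). [cite: Koblitz1984, Ch. IV §4 (Newton polygon of a power series)] [cite: Washington1997, §7.1–7.2] -/
theorem norm_leading_binomial_lt_of_hasSum_zero_of_strictChord {G : IwasawaAlgebra p} (hG0 : G ≠ 0)
    (hμ : mu G = 0) (hc0 : PowerSeries.constantCoeff G ≠ 0)
    (hchord : ∀ k, 0 < k → k < lam G →
      ‖PowerSeries.coeff k G‖ ^ lam G < ‖PowerSeries.constantCoeff G‖ ^ (lam G - k))
    {z : ℂ_[p]} (hz : ‖z‖ < 1)
    (hsum : HasSum (fun k ↦ ((algebraMap ℚ_[p] ℂ_[p]).comp (algebraMap ℤ_[p] ℚ_[p]))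
      (PowerSeries.coeff k G) * z ^ k) 0) :
    ‖((algebraMap ℚ_[p] ℂ_[p]).comp (algebraMap ℤ_[p] ℚ_[p])) (PowerSeries.coeff 0 G) +
      ((algebraMap ℚ_[p] ℂ_[p]).comp (algebraMap ℤ_[p] ℚ_[p])) (PowerSeries.coeff (lam G) G) *
        z ^ lam G‖ < ‖PowerSeries.constantCoeff G‖ := by
  set ιZ : ℤ_[p] →+* ℂ_[p] := (algebraMap ℚ_[p] ℂ_[p]).comp (algebraMap ℤ_[p] ℚ_[p]) with hιZ
  set c : ℝ := ‖PowerSeries.constantCoeff G‖ with hc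
  have hcpos : 0 < c := norm_pos_iff.mpr hc0
  have hs0 : 0 ≤ ‖z‖ := norm_nonneg _
  -- the (non-strict) chord condition holds, so `|z|^λ = c`
  have hchord' : ∀ k, 0 < k → k < lam G →
      ‖PowerSeries.coeff k G‖ ^ lam G ≤ ‖PowerSeries.constantCoeff G‖ ^ (lam G - k) :=
    fun k hk0 hk ↦ (hchord k hk0 hk).le
  have hzl : ‖z‖ ^ lam G = c := norm_pow_lam_eq_of_hasSum_zero_of_chord hG0 hμ hchord' hz hsum
  -- `λ ≥ 1`: otherwise `G` is a unit (`c = 1 = |z|^0`... impossible since a unit has no zero)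
  have hlam1 : 1 ≤ lam G := by
    by_contra hlt
    rw [not_le, Nat.lt_one_iff] at hlt
    have h1 := norm_coeff_lam_eq_one hG0 hμ
    rw [hlt, norm_coeff_zero_eq] at h1
    rw [hlt, pow_zero] at hzl
    -- `c = 1`: then `G` is a unit and has no zero in the open disc
    have hunit : IsUnit G := by
      rw [PowerSeries.isUnit_iff_constantCoeff, PadicInt.isUnit_iff]; exact h1
    have hval := norm_tsum_eq_one_of_isUnit hunit hz
    rw [hsum.tsum_eq, norm_zero] at hval
    exact one_ne_zero hval.symm
  -- every other term is `< c`; uniform bound `δ = max(max over 0<k<λ, c·|z|)`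
  have hfin : ∀ k, 0 < k → k < lam G → ‖ιZ (PowerSeries.coeff k G) * z ^ k‖ < c := by
    intro k hk0 hk
    rw [norm_mul, norm_pow, hιZ, norm_algebraMap_comp_apply]
    refine lt_of_pow_lt_pow_left₀ (lam G) hcpos.le ?_
    calc (‖PowerSeries.coeff k G‖ * ‖z‖ ^ k) ^ lam G
        = ‖PowerSeries.coeff k G‖ ^ lam G * (‖z‖ ^ lam G) ^ k := by
          rw [mul_pow, ← pow_mul, mul_comm k, pow_mul]
      _ < c ^ (lam G - k) * (‖z‖ ^ lam G) ^ k :=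
          mul_lt_mul_of_pos_right (hchord k hk0 hk) (pow_pos (by rw [hzl]; exact hcpos) _)
      _ = c ^ lam G := by rw [hzl, ← pow_add, Nat.sub_add_cancel hk.le]
  obtain ⟨δ₁, hδ₁lt, hδ₁0, hδ₁⟩ : ∃ δ₁ : ℝ, δ₁ < c ∧ 0 ≤ δ₁ ∧
      ∀ k, 0 < k → k < lam G → ‖ιZ (PowerSeries.coeff k G) * z ^ k‖ ≤ δ₁ := by
    by_cases hne : (Finset.Ioo 0 (lam G)).Nonempty
    · obtain ⟨k₁, hk₁, hmax⟩ := Finset.exists_max_image (Finset.Ioo 0 (lam G))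
        (fun k ↦ ‖ιZ (PowerSeries.coeff k G) * z ^ k‖) hne
      rw [Finset.mem_Ioo] at hk₁
      exact ⟨_, hfin k₁ hk₁.1 hk₁.2, norm_nonneg _,
        fun k hk0 hk ↦ hmax k (Finset.mem_Ioo.mpr ⟨hk0, hk⟩)⟩
    · refine ⟨0, hcpos, le_rfl, fun k hk0 hk ↦ ?_⟩
      exact absurd ⟨k, Finset.mem_Ioo.mpr ⟨hk0, hk⟩⟩ hne
  set δ : ℝ := max δ₁ (c * ‖z‖) with hδ
  have hδlt : δ < c := by
    refine max_lt hδ₁lt ?_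
    calc c * ‖z‖ < c * 1 := mul_lt_mul_of_pos_left hz hcpos
      _ = c := mul_one _
  have hδ0 : 0 ≤ δ := le_trans hδ₁0 (le_max_left _ _)
  have hother : ∀ k, k ≠ 0 → k ≠ lam G → ‖ιZ (PowerSeries.coeff k G) * z ^ k‖ ≤ δ := by
    intro k hk0 hkl
    rcases lt_or_gt_of_ne hkl with hlt | hgt
    · exact le_trans (hδ₁ k (Nat.pos_of_ne_zero hk0) hlt) (le_max_left _ _)
    · rw [norm_mul, norm_pow]
      calc ‖ιZ (PowerSeries.coeff k G)‖ * ‖z‖ ^ k ≤ 1 * ‖z‖ ^ (lam G + 1) :=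
            mul_le_mul (norm_algebraMap_coeff_le_one G k) (pow_le_pow_of_le_one hs0 hz.le hgt)
              (pow_nonneg hs0 _) zero_le_one
        _ = c * ‖z‖ := by rw [one_mul, pow_succ, hzl]
        _ ≤ δ := le_max_right _ _
  have hbound := norm_tsum_sub_two_le G hz (show (0 : ℕ) ≠ lam G by omega) hδ0 hother
  rw [hsum.tsum_eq, zero_sub, norm_neg, pow_zero, mul_one] at hbound
  exact lt_of_le_of_lt hbound hδlt

end Leading

/-! ## §2. Residual separation under the strict chord condition -/

section Residual

/-- **RESIDUAL SEPARATION, any leading valuation.** `F, G ∈ Λ ∖ {0}`, `μ(F) = μ(G) = 0`, nonzero constant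
terms of the SAME absolute value `‖F_0‖ = ‖G_0‖`, `λ(F) = λ(G) =: λ`, strict chord conditions, and the
certificate **`‖F_0·G_λ − G_0·F_λ‖ = ‖F_0‖`**: no common zero in the open unit disc of `ℂ_p`
(`F_0G_λ − G_0F_λ = G_λ(F_0 + F_λ w) − F_λ(G_0 + G_λ w)`, both binomials `< ‖F_0‖` at a common zero).
[cite: Koblitz1984, Ch. IV §4 (Newton polygon of a power series)] [cite: Washington1997, §7.1–7.2 and Thm. 7.3] -/
theorem not_common_zero_of_residual_of_strictChord {F G : IwasawaAlgebra p} (hF0 : F ≠ 0) (hG0 : G ≠ 0)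
    (hμF : mu F = 0) (hμG : mu G = 0)
    (hFc : PowerSeries.constantCoeff F ≠ 0)
    (hFG : ‖PowerSeries.constantCoeff F‖ = ‖PowerSeries.constantCoeff G‖) (hlam : lam F = lam G)
    (hchF : ∀ k, 0 < k → k < lam F →
      ‖PowerSeries.coeff k F‖ ^ lam F < ‖PowerSeries.constantCoeff F‖ ^ (lam F - k))
    (hchG : ∀ k, 0 < k → k < lam G →
      ‖PowerSeries.coeff k G‖ ^ lam G < ‖PowerSeries.constantCoeff G‖ ^ (lam G - k))
    (hres : ‖PowerSeries.constantCoeff F * PowerSeries.coeff (lam G) G -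
      PowerSeries.constantCoeff G * PowerSeries.coeff (lam F) F‖ = ‖PowerSeries.constantCoeff F‖)
    {z : ℂ_[p]} (hz : ‖z‖ < 1)
    (hFz : HasSum (fun k ↦ ((algebraMap ℚ_[p] ℂ_[p]).comp (algebraMap ℤ_[p] ℚ_[p]))
      (PowerSeries.coeff k F) * z ^ k) 0)
    (hGz : HasSum (fun k ↦ ((algebraMap ℚ_[p] ℂ_[p]).comp (algebraMap ℤ_[p] ℚ_[p]))
      (PowerSeries.coeff k G) * z ^ k) 0) : False := by
  set ιZ : ℤ_[p] →+* ℂ_[p] := (algebraMap ℚ_[p] ℂ_[p]).comp (algebraMap ℤ_[p] ℚ_[p]) with hιZ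
  have hGc : PowerSeries.constantCoeff G ≠ 0 := by
    intro h; rw [h, norm_zero, norm_eq_zero] at hFG; exact hFc hFG
  have hF' := norm_leading_binomial_lt_of_hasSum_zero_of_strictChord hF0 hμF hFc hchF hz hFz
  have hG' := norm_leading_binomial_lt_of_hasSum_zero_of_strictChord hG0 hμG hGc hchG hz hGz
  rw [hlam] at hF'
  rw [← hFG] at hG'
  set w : ℂ_[p] := z ^ lam G with hw
  have hid : ιZ (PowerSeries.constantCoeff F * PowerSeries.coeff (lam G) G -
      PowerSeries.constantCoeff G * PowerSeries.coeff (lam F) F) =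
      ιZ (PowerSeries.coeff (lam G) G) * (ιZ (PowerSeries.coeff 0 F) + ιZ (PowerSeries.coeff (lam G) F) * w) -
      ιZ (PowerSeries.coeff (lam G) F) * (ιZ (PowerSeries.coeff 0 G) + ιZ (PowerSeries.coeff (lam G) G) * w) := by
    rw [hlam, map_sub, map_mul, map_mul, ← PowerSeries.coeff_zero_eq_constantCoeff_apply,
      ← PowerSeries.coeff_zero_eq_constantCoeff_apply]
    ring
  have hnorm : ‖ιZ (PowerSeries.constantCoeff F * PowerSeries.coeff (lam G) G -
      PowerSeries.constantCoeff G * PowerSeries.coeff (lam F) F)‖ < ‖PowerSeries.constantCoeff F‖ := by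
    rw [hid, sub_eq_add_neg]
    refine lt_of_le_of_lt (IsUltrametricDist.norm_add_le_max _ _) (max_lt ?_ ?_)
    · rw [norm_mul]
      calc ‖ιZ (PowerSeries.coeff (lam G) G)‖ *
            ‖ιZ (PowerSeries.coeff 0 F) + ιZ (PowerSeries.coeff (lam G) F) * w‖
          ≤ 1 * ‖ιZ (PowerSeries.coeff 0 F) + ιZ (PowerSeries.coeff (lam G) F) * w‖ :=
            mul_le_mul_of_nonneg_right (norm_algebraMap_coeff_le_one G _) (norm_nonneg _)
        _ < ‖PowerSeries.constantCoeff F‖ := by rw [one_mul]; exact hF'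
    · rw [norm_neg, norm_mul]
      calc ‖ιZ (PowerSeries.coeff (lam G) F)‖ *
            ‖ιZ (PowerSeries.coeff 0 G) + ιZ (PowerSeries.coeff (lam G) G) * w‖
          ≤ 1 * ‖ιZ (PowerSeries.coeff 0 G) + ιZ (PowerSeries.coeff (lam G) G) * w‖ :=
            mul_le_mul_of_nonneg_right (norm_algebraMap_coeff_le_one F _) (norm_nonneg _)
        _ < ‖PowerSeries.constantCoeff F‖ := by rw [one_mul]; exact hG'
  rw [hιZ, norm_algebraMap_comp_apply, hres] at hnorm
  exact lt_irrefl _ hnorm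

/-- **NO COMMON HEIGHT-ONE PRIME under residual separation (strict chord, any leading valuation).**
[cite: Washington1997, §7.1–7.2, Thm. 7.3 and §13.2] [cite: Koblitz1984, Ch. IV §4 (Newton polygon of a power series)] -/
theorem not_mem_and_mem_of_residual_of_strictChord {F G : IwasawaAlgebra p} (hF0 : F ≠ 0) (hG0 : G ≠ 0)
    (hμF : mu F = 0) (hμG : mu G = 0)
    (hFc : PowerSeries.constantCoeff F ≠ 0)
    (hFG : ‖PowerSeries.constantCoeff F‖ = ‖PowerSeries.constantCoeff G‖) (hlam : lam F = lam G)
    (hchF : ∀ k, 0 < k → k < lam F →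
      ‖PowerSeries.coeff k F‖ ^ lam F < ‖PowerSeries.constantCoeff F‖ ^ (lam F - k))
    (hchG : ∀ k, 0 < k → k < lam G →
      ‖PowerSeries.coeff k G‖ ^ lam G < ‖PowerSeries.constantCoeff G‖ ^ (lam G - k))
    (hres : ‖PowerSeries.constantCoeff F * PowerSeries.coeff (lam G) G -
      PowerSeries.constantCoeff G * PowerSeries.coeff (lam F) F‖ = ‖PowerSeries.constantCoeff F‖)
    (𝔭 : PrimeSpectrum (IwasawaAlgebra p)) (h𝔭 : 𝔭.asIdeal.height = 1) :
    ¬ (F ∈ 𝔭.asIdeal ∧ G ∈ 𝔭.asIdeal) := by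
  rintro ⟨hF𝔭, hG𝔭⟩
  rcases IwasawaAlgebra.eq_span_of_height_eq_one p 𝔭.asIdeal h𝔭 with hp𝔭 | ⟨f, hf, hirr, hf𝔭⟩
  · rw [hp𝔭, Ideal.mem_span_singleton] at hF𝔭
    have h1 : 1 ≤ mu F := le_mu_of_C_pow_dvd hF0 (by rwa [pow_one])
    omega
  · obtain ⟨z, hz, hzero⟩ := exists_common_zero_of_span_distinguished hf hirr
    rw [hf𝔭] at hF𝔭 hG𝔭
    exact not_common_zero_of_residual_of_strictChord hF0 hG0 hμF hμG hFc hFG hlam hchF hchG hres hz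
      (hzero F hF𝔭) (hzero G hG𝔭)

/-- **The `T`-shifted form** (off `(T)`). [cite: Washington1997, §7.1–7.2, Thm. 7.3 and §13.2] -/
theorem not_mem_and_mem_of_X_mul_of_residual_of_strictChord {F G F₁ G₁ : IwasawaAlgebra p}
    (hFF : F = PowerSeries.X * F₁) (hGG : G = PowerSeries.X * G₁) (hF0 : F₁ ≠ 0) (hG0 : G₁ ≠ 0)
    (hμF : mu F₁ = 0) (hμG : mu G₁ = 0)
    (hFc : PowerSeries.constantCoeff F₁ ≠ 0)
    (hFG : ‖PowerSeries.constantCoeff F₁‖ = ‖PowerSeries.constantCoeff G₁‖) (hlam : lam F₁ = lam G₁)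
    (hchF : ∀ k, 0 < k → k < lam F₁ →
      ‖PowerSeries.coeff k F₁‖ ^ lam F₁ < ‖PowerSeries.constantCoeff F₁‖ ^ (lam F₁ - k))
    (hchG : ∀ k, 0 < k → k < lam G₁ →
      ‖PowerSeries.coeff k G₁‖ ^ lam G₁ < ‖PowerSeries.constantCoeff G₁‖ ^ (lam G₁ - k))
    (hres : ‖PowerSeries.constantCoeff F₁ * PowerSeries.coeff (lam G₁) G₁ -
      PowerSeries.constantCoeff G₁ * PowerSeries.coeff (lam F₁) F₁‖ = ‖PowerSeries.constantCoeff F₁‖)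
    (𝔭 : PrimeSpectrum (IwasawaAlgebra p)) (h𝔭 : 𝔭.asIdeal.height = 1)
    (hT : (PowerSeries.X : IwasawaAlgebra p) ∉ 𝔭.asIdeal) :
    ¬ (F ∈ 𝔭.asIdeal ∧ G ∈ 𝔭.asIdeal) := by
  rintro ⟨hF𝔭, hG𝔭⟩
  rw [hFF] at hF𝔭
  rw [hGG] at hG𝔭
  exact not_mem_and_mem_of_residual_of_strictChord hF0 hG0 hμF hμG hFc hFG hlam hchF hchG hres 𝔭 h𝔭
    ⟨(𝔭.isPrime.mem_or_mem hF𝔭).resolve_left hT, (𝔭.isPrime.mem_or_mem hG𝔭).resolve_left hT⟩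

end Residual

end Summit.BirchSwinnertonDyer.BirchSwinnertonDyer.Theorems.ChromaticSlopeSeparation

end
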